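import Literature.MathematicalPhysics.QuantumFieldTheory.Balaban1983to89.B9SectCDiffCutModelToy4

/-!
# `Balaban1983to89.B9SectCDiffCutModelToy5` — the INVERSE SIDE of the one-level toy: the massive operator
`H_μ = ∂*∂ + μ` for the non-zero Dirichlet difference `∂ = S − 1` of Toy4, the finite MAXIMUM PRINCIPLE for
dominant Z-matrices, the Green's function `G′ = H_μ⁻¹` (existence, entrywise positivity, symmetry), its exponential
decay by comparison with an explicit Neumann-image supersolution, the UNIMODALITY of its columns with the gradient
bound, and the (M)-field classes `G′ ∈ 𝒟(0, 2, 4e^{1/2})`, `∂G′ ∈ 𝒟(0, 1, 4e)` on the toy frame at mass `m = 1/B`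
with constants and rate independent of `B`, `n` and the zone (census `b2b-balaban-r1/SectC-inst-census.md` §6 (a⁵),
first half: "the inverse side", note N10)

B9 = T. Bałaban, *Propagators for lattice gauge theories in a background field*, Commun. Math. Phys. **99**, 389–434
(1985) [Balaban1985BackgroundPropagators].

CITATION HEADER (lean-in-tree rule 2026-08-18).  Cell `pub-balaban`, unit `b2b-balaban-r1-g16` (READER GROUP A,
lineage r1, gen 16, second leaf), journal claim `SECTC-DIFF-CUTMODEL-TOY5`.  Source: doi:10.1007/bf01240355, held
`paper:balaban1985-cmp99-background-propagators`, journal page = PDF page + 388.  This unit re-read NO page and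
introduces NO quotation: the field SHAPES inhabited here — `MOne.mG' : OpDec F bs bs p p 0 2 c G′` and
`MOne.mDG' : OpDec F bb bs p p 0 1 c (∂·G′)` of `…B9SectCDiffAssembly`, i.e. two of the per-sequence fields of
hypothesis (M) of `…B9SectCDiffEstimate.EstHyp` — carry the scale powers (`G′ ↦ 2`, `∂G′ ↦ 1`) of B9's Theorem 3.1
(3.42), p. 397 [PDF 9], whose sentence is quoted VERBATIM in `…B9SectCDiffEstimate`'s header and in the docstrings of
`WDec` / `BlkMaj.of_opBound` there; the present declarations point to that quotation BY NAME only.  Tree inputs (by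
name): `B9SectCDiffEstimate.{Frame, Frame.rate_zero, BlkMaj, WDec, OpDec}`, `B9SectCDiffCutModelToy.{bdist,
bdist_nonneg}`, `B9SectCDiffCutModelToy3.{toyFrame, toyFrame_ρ, toyFrame_sc, toyFrame_δ₀}`,
`B9SectCDiffCutModelToy4.{ι, ι_lt, ι_injective, ι_site, site, exists_succ, exists_pred, Sh, Sh_apply, sum_Sh_mul,
sum_Sh_mul_of_last, sum_mul_Sh, sum_mul_Sh_of_first, Dfw, Dbw}`; Mathlib's non-singular-inverse API
(`Matrix.mulVec_injective_iff_isUnit`, `Matrix.isUnit_iff_isUnit_det`, `Matrix.mul_nonsing_inv`,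
`Matrix.nonsing_inv_mul`, `Matrix.transpose_nonsing_inv`), `Real.abs_exp_sub_one_sub_id_le`, `Real.add_one_le_exp`,
`Finset.sum_range_sub` otherwise.  Cell rows: GAPS C-r1g13-1 (the cut model), C-r1g14-1 / C-r1g15-1 / C-r1g15-2 /
C-r1g16-1 (the toys 1–4), this module's row C-r1g16-2; census `b2b-balaban-r1/SectC-inst-census.md` §6 (a⁵) / notes
N10–N11.  No `HarnessLib` fact, no named-fact `Prop`, no `instance`; one Prop-valued predicate on matrices
(`IsDomZ`, never assumed downstream: PROVED for `H_μ` in `isDomZ_Hm`); no `sorry`.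

## WHAT THIS MODULE DOES

Gen 16's first leaf (Toy4) made the differential block of the cut model non-zero (`∂ = S − 1` with exact Leibniz
identities and computed coefficient classes); census note N10 recorded the one missing ingredient for a cut-model /
`EstHyp` instance WITH `∂ ≠ 0` on the toy: the inverse side — lattice resolvents with genuine off-diagonal decay
whose (M)-class constants do not grow with the block size `B` at mass `m ~ 1/B`.  This leaf proves it for `G′` and
`∂G′` — elementary, but a genuine decay proof (the toy shadow of the ROLE played by B9's Theorems 3.1–3.3):
* §1 the finite maximum principle: `IsDomZ A` (off-diagonal entries `≤ 0`, row sums `> 0`) gives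
  `A·u ≥ 0 ⇒ u ≥ 0` entrywise (`IsDomZ.nonneg_of_mulVec_nonneg`, argmin argument), hence `A` is injective and
  invertible (`mulVec_injective`, `isUnit`, `isUnit_det`, `mul_inv`, `inv_mul`), `A⁻¹ ≥ 0` entrywise (`inv_nonneg`),
  and the COMPARISON PRINCIPLE `inv_le_of_supersol`: `A·φ ≥ e_j` entrywise ⇒ `A⁻¹(·, j) ≤ φ`;
* §2 `E_first` (`Ef`), `SᵀS = 1 − E_first` (`transpose_mul_Sh`), **`H_μ := ∂*∂ + μ·1 = (2+μ)·1 − E_first − S − Sᵀ`**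
  (`Hm`, `Hm_eq`, `Hm_apply`, `Hm_mulVec`, `Hm_transpose`: Neumann row at the first site, Dirichlet beyond the last),
  `isDomZ_Hm` (row sums `≥ μ > 0`), and **`G′ := H_μ⁻¹`** (`Gr`, `Hm_mul_Gr`, `Gr_mul_Hm`, **`Gr_nonneg`**,
  `Gr_transpose`);
* §3 the supersolution `F_b(a) = e^{−t|a−b|} + e^{−t(a+b+1)}` (`prof`; the second term is the image across the
  Neumann end, `prof_neg_one : F_b(−1) = F_b(0)`): if `e^t + e^{−t} ≤ 2 + μ` then
  `(H_μF_{ι y})(x) ≥ [x = y]·(2 + μ − 2e^{−t})` (`three_term`, `three_term_nonneg(')`, `prof_three_term`,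
  `Hm_mulVec_prof`; at the Dirichlet end a non-negative term is dropped), whence by comparison **`Gr_le_prof`** and
  **`Gr_le : G′(x, y) ≤ 2(2 + μ − 2e^{−t})⁻¹·e^{−t|ι x − ι y|}`** (`μ > 0`, `t ≥ 0`);
* §4 the mass parametrisation `μ = m²`, `t = m/2`, `0 < m ≤ 1`: `cosh(m/2) ≤ 1 + m²/2` (`cosh_half_le`) and
  `2 + m² − 2e^{−m/2} ≥ m/2` (`half_le_defect`) give **`Gr_mass_le : 0 ≤ G′(x, y) ≤ (4/m)·e^{−(m/2)|ι x − ι y|}`**;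
* §5 at `m = 1/B`: `|ι x − ι y| ≥ B(|I_x − I_y| − 1)` (`dι_ge`), `site_factor_le`, `card_block_le`, the block row
  sums **`Gr_block_rowsum : Σ_{y ∈ J}|G′(x, y)| ≤ 4e^{1/2}·B²·e^{−|I_x − J|/2}`** and **`Gr_opDec : G′ ∈
  𝒟(0, 2, 4e^{1/2})` on `toyFrame n B N _ δ₀` for every `δ₀ ≤ 1/2`** — the `MOne.mG'` SHAPE with a constant that
  sees neither `B` nor `n` nor the zone `N`;
* §6 the gradient.  The maximum principle alone bounds `|∂G′|` only by `O(1/m) = O(B)` per entry; the missing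
  factor comes from the SHAPE of the columns.  Reading `H_μG′ = 1` along the linear index (`U` = the column extended
  by `0` past the last site; `row_eq`, `rec_int`, `rec_zero`, `src_int`, `src_zero`), the forward differences
  `W(i) = U(i+1) − U(i)` satisfy `W(0) = μU(0) ≥ 0`, `W(i+1) = W(i) + μU(i+1)` left of the source (`W_zero`,
  `W_succ`) and the drops `D(a) = U(a) − U(a+1)` satisfy `D(a) = D(a+1) + μU(a+1)`, `D(last) = U(last) ≥ 0` right
  of it (`D_succ`): **every column increases up to its diagonal entry and decreases after it, with convex flanks**
  (`W_nonneg`, `W_mono`, `D_nonneg`, `D_anti`; in matrix form `Gr_le_Gr_succ`, `Gr_succ_le_Gr`), the jumps at the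
  source are `≤ 1` (`D_src_le_one`, `W_src_le_one`, **`absW_le_one : |U(i+1) − U(i)| ≤ 1`**), and TELESCOPING
  over `B` consecutive monotone differences (`W_tele`, `D_tele`: `B·|W(i)| ≤ U` at a site `B` steps closer to the
  source) against the decay of §4 (`U_le`) gives **`absW_le : |U(i+1) − U(i)| ≤ 4e^{1/2}·e^{−|i − ι y|/(2B)}`** at
  `m = 1/B` — an `O(1)` bound, one power of `B` better than `G′` itself — and `DGr_apply` /
  **`DGr_entry_le : |(∂G′)(x, y)| ≤ 4e^{1/2}·e^{−|ι x − ι y|/(2B)}`**;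
* §7 **`DGr_block_rowsum : Σ_{y ∈ J}|(∂G′)(x, y)| ≤ 4e·B·e^{−|I_x − J|/2}`** and **`DGr_opDec : ∂G′ ∈ 𝒟(0, 1, 4e)`
  on the toy frame (`δ₀ ≤ 1/2`)** — the `MOne.mDG'` SHAPE, again with a `B`-, `n`-, `N`-free constant.

## WHAT IS NOT CLAIMED (ABSOLUTE RULE)

Nothing printed is asserted.  This is the one-dimensional discrete Helmholtz equation on a path (folklore: M-matrix
/ maximum-principle facts and an explicit comparison function); B9's Theorems 3.1–3.3 concern gauge-covariant
operators in a background field on a four-dimensional multi-level lattice with averaging operators, and nothing here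
bears on them or on their printed proofs.  NOT done (census §6 (a⁵), second half; note N11): the remaining
inverse-side data `G = (m′² + ∂∂*)⁻¹` (the same engine with the boundary rows exchanged), the coarse operator
`C = (Q′G′²Q′*)⁻¹ ∈ 𝒟(0, −4, c)` (needs a LOWER bound on `E = Q′G′²Q′*`, the toy shadow of (3.47)/(3.48)), the
packaging of Toy4's Leibniz block, gen 15's Q-records and the present classes into a `TwoSeq` / `CutModel` /
`EstHyp` instance with `∂ ≠ 0`, and an `n`-free majorant profile (downstream the majorant `K` is summed over all
blocks).  The decay RATE obtained is `1/2` per block at `m = 1/B` (from `t = m/2`; any `t` with `cosh t ≤ 1 + m²/2`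
works, with another constant), and the frame's `δ₀` is restricted to `δ₀ ≤ 1/2` accordingly; the constants
`4e^{1/2}`, `4e` are not optimised.  `toyFrame` is reused as typed in gen 15 (its `u = δ₀/20` makes `Frame.σ = 0`
downstream, census note to C-pv15g8-10 R1) — immaterial here, where only `Frame.rate 0 = δ₀` enters.  Value = the
kernel certificate that the (M)-classes of `G′` and `∂G′` hold on the toy with the printed scale powers `2` and `1`
and constants that do not see the block size — NOT summit progress.
-/

namespace Literature.MathematicalPhysics.QuantumFieldTheory.Balaban1983to89.B9SectCDiffCutModelToy5

open Finset Real
open B9SectCDiffEstimate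
open B9SectCDiffCutModel
open B9SectCDiffCutModelToy
open B9SectCDiffCutModelToy2
open B9SectCDiffCutModelToy3
open B9SectCDiffCutModelToy4

noncomputable section

/-! ## §1 The finite maximum principle for dominant Z-matrices -/

section MaxPrinciple

variable {α : Type*} [Fintype α] [DecidableEq α]

/-- a DOMINANT Z-MATRIX: non-positive off-diagonal entries and positive row sums (a strictly
diagonally dominant matrix of «M-matrix» sign pattern). OURS (typing). [folklore] -/
structure IsDomZ (A : Matrix α α ℝ) : Prop where
  /-- off-diagonal entries are `≤ 0` -/
  offdiag : ∀ i j, i ≠ j → A i j ≤ 0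
  /-- row sums are `> 0` -/
  rowsum : ∀ i, 0 < ∑ j, A i j

namespace IsDomZ

variable {A : Matrix α α ℝ}

/-- THE (weak) MAXIMUM PRINCIPLE: for a dominant Z-matrix, `Au ≥ 0` entrywise forces `u ≥ 0`
(look at a minimum of `u`). [folklore] -/
theorem nonneg_of_mulVec_nonneg (hA : IsDomZ A) {u : α → ℝ} (hu : ∀ i, 0 ≤ A.mulVec u i) (i : α) :
    0 ≤ u i := by
  obtain ⟨i₀, -, hmin⟩ := exists_min_image univ u ⟨i, mem_univ i⟩
  have hmin' : ∀ j, u i₀ ≤ u j := fun j => hmin j (mem_univ j)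
  by_contra hneg
  have h0 : u i₀ < 0 := lt_of_le_of_lt (hmin' i) (lt_of_not_ge hneg)
  have key : A.mulVec u i₀ ≤ (∑ j, A i₀ j) * u i₀ := by
    simp only [Matrix.mulVec, dotProduct, Finset.sum_mul]
    refine sum_le_sum fun j _ => ?_
    by_cases hj : i₀ = j
    · rw [hj]
    · exact mul_le_mul_of_nonpos_left (hmin' j) (hA.offdiag i₀ j hj)
  have h1 : (∑ j, A i₀ j) * u i₀ < 0 := mul_neg_of_pos_of_neg (hA.rowsum i₀) h0
  linarith [hu i₀]

/-- a dominant Z-matrix has injective action. [folklore] -/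
theorem mulVec_injective (hA : IsDomZ A) : Function.Injective A.mulVec := by
  intro u v huv
  funext i
  have h1 := hA.nonneg_of_mulVec_nonneg (u := u - v) (fun j => by simp [Matrix.mulVec_sub, huv]) i
  have h2 := hA.nonneg_of_mulVec_nonneg (u := v - u) (fun j => by simp [Matrix.mulVec_sub, huv]) i
  simp only [Pi.sub_apply, sub_nonneg] at h1 h2
  exact le_antisymm h2 h1

/-- a dominant Z-matrix is invertible. [folklore] -/
theorem isUnit (hA : IsDomZ A) : IsUnit A := Matrix.mulVec_injective_iff_isUnit.mp hA.mulVec_injective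

/-- [folklore] -/
theorem isUnit_det (hA : IsDomZ A) : IsUnit A.det := (Matrix.isUnit_iff_isUnit_det A).mp hA.isUnit

/-- [folklore] -/
theorem mul_inv (hA : IsDomZ A) : A * A⁻¹ = 1 := Matrix.mul_nonsing_inv A hA.isUnit_det

/-- [folklore] -/
theorem inv_mul (hA : IsDomZ A) : A⁻¹ * A = 1 := Matrix.nonsing_inv_mul A hA.isUnit_det

omit [DecidableEq α] in
/-- the action on a column of a matrix is the column of the product. [folklore] -/
theorem _root_.Literature.MathematicalPhysics.QuantumFieldTheory.Balaban1983to89.B9SectCDiffCutModelToy5.mulVec_col_apply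
    (A G : Matrix α α ℝ) (i j : α) : A.mulVec (fun k => G k j) i = (A * G) i j := by
  simp only [Matrix.mulVec, dotProduct, Matrix.mul_apply]

/-- INVERSE POSITIVITY: the inverse of a dominant Z-matrix is entrywise non-negative. [folklore] -/
theorem inv_nonneg (hA : IsDomZ A) (i j : α) : 0 ≤ A⁻¹ i j :=
  hA.nonneg_of_mulVec_nonneg (u := fun k => A⁻¹ k j)
    (fun i' => by rw [mulVec_col_apply, hA.mul_inv, Matrix.one_apply]; split_ifs <;> norm_num) i

/-- COMPARISON: a supersolution for the `j`-th unit vector dominates the `j`-th column of the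
inverse. [folklore] -/
theorem inv_le_of_supersol (hA : IsDomZ A) (j : α) {φ : α → ℝ}
    (hφ : ∀ i, (if i = j then (1 : ℝ) else 0) ≤ A.mulVec φ i) (i : α) : A⁻¹ i j ≤ φ i := by
  have h := hA.nonneg_of_mulVec_nonneg (u := φ - fun k => A⁻¹ k j) (fun i' => by
    rw [Matrix.mulVec_sub, Pi.sub_apply, mulVec_col_apply, hA.mul_inv, Matrix.one_apply, sub_nonneg]
    exact hφ i') i
  simpa only [Pi.sub_apply, sub_nonneg] using h

end IsDomZ

end MaxPrinciple

/-! ## §2 The massive Helmholtz operator of the toy line -/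

section Helmholtz

variable {n B : ℕ}

/-- the projection on the first site (no predecessor). OURS (typing). [folklore] -/
def Ef (n B : ℕ) : Matrix (Fin n × Fin B) (Fin n × Fin B) ℝ :=
  Matrix.diagonal fun x => if ι x = 0 then 1 else 0

/-- `Sᵀ·S = 1 − E_first`. [folklore] -/
theorem transpose_mul_Sh : (Sh n B).transpose * Sh n B = 1 - Ef n B := by
  ext y y'
  rw [Matrix.mul_apply, Matrix.sub_apply, Matrix.one_apply, Ef, Matrix.diagonal_apply]
  simp only [Matrix.transpose_apply]
  rw [show ∑ x, Sh n B x y * Sh n B x y' = ∑ x, Sh n B x y' * Sh n B x y from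
      sum_congr rfl fun x _ => mul_comm _ _]
  by_cases hy : ι y = 0
  · have hy' : ∀ x : Fin n × Fin B, ι y ≠ ι x + 1 := fun x h => by omega
    rw [sum_mul_Sh_of_first hy']
    by_cases hyy : y = y'
    · subst hyy; rw [if_pos rfl, if_pos rfl, if_pos hy]; norm_num
    · rw [if_neg hyy, if_neg hyy]; norm_num
  · obtain ⟨x, hx⟩ := exists_pred (Nat.pos_of_ne_zero hy)
    rw [sum_mul_Sh hx]
    by_cases hyy : y = y'
    · subst hyy; rw [if_pos rfl, if_pos rfl, if_neg hy, Sh_apply, if_pos hx]; norm_num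
    · rw [if_neg hyy, if_neg hyy, Sh_apply, if_neg]
      · norm_num
      · intro h; exact hyy (ι_inj.1 (by omega))

/-- the MASSIVE HELMHOLTZ OPERATOR of the toy: `H_μ := ∂*∂ + μ·1` (`∂ = S − 1`, `∂* = Sᵀ − 1` of
Toy4: Neumann condition at the first site, Dirichlet at the last). OURS (typing). [folklore] -/
def Hm (n B : ℕ) (μ : ℝ) : Matrix (Fin n × Fin B) (Fin n × Fin B) ℝ :=
  Dbw n B * Dfw n B + μ • (1 : Matrix (Fin n × Fin B) (Fin n × Fin B) ℝ)

/-- `H_μ = (2+μ)·1 − E_first − S − Sᵀ`. [folklore] -/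
theorem Hm_eq (μ : ℝ) :
    Hm n B μ = (2 + μ) • (1 : Matrix (Fin n × Fin B) (Fin n × Fin B) ℝ) - Ef n B - Sh n B
      - (Sh n B).transpose := by
  unfold Hm Dbw Dfw
  rw [sub_mul, mul_sub, mul_sub, transpose_mul_Sh]
  simp only [Matrix.mul_one, Matrix.one_mul]
  ext x y
  simp only [Matrix.add_apply, Matrix.sub_apply, Matrix.smul_apply, Matrix.one_apply, smul_eq_mul]
  ring

/-- the entries of `H_μ`. [folklore] -/
theorem Hm_apply (μ : ℝ) (x y : Fin n × Fin B) :
    Hm n B μ x y = (if x = y then 2 + μ - (if ι x = 0 then 1 else 0) else 0) - Sh n B x y - Sh n B y x := by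
  rw [Hm_eq]
  simp only [Matrix.sub_apply, Matrix.smul_apply, Matrix.one_apply, smul_eq_mul, Ef,
    Matrix.diagonal_apply, Matrix.transpose_apply]
  split_ifs <;> ring

/-- the action of `H_μ`: `(H_μu)(x) = (2+μ)u(x) − [x first]·u(x) − u(x+1)·[x+1 exists] − u(x−1)·[x−1 exists]`.
[folklore] -/
theorem Hm_mulVec (μ : ℝ) (u : Fin n × Fin B → ℝ) (x : Fin n × Fin B) :
    (Hm n B μ).mulVec u x = (2 + μ) * u x - (if ι x = 0 then (1 : ℝ) else 0) * u x
      - (∑ z, Sh n B x z * u z) - ∑ z, u z * Sh n B z x := by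
  rw [Hm_eq]
  simp only [Matrix.sub_mulVec, Pi.sub_apply, Matrix.smul_mulVec, Matrix.one_mulVec, Pi.smul_apply,
    smul_eq_mul]
  rw [Ef, Matrix.mulVec_diagonal, Matrix.mulVec_transpose]
  simp only [Matrix.mulVec, Matrix.vecMul, dotProduct]

/-- `H_μ` is symmetric. [folklore] -/
theorem Hm_transpose (μ : ℝ) : (Hm n B μ).transpose = Hm n B μ := by
  unfold Hm
  rw [Matrix.transpose_add, Matrix.transpose_mul, Dbw_eq_transpose, Matrix.transpose_transpose,
    Matrix.transpose_smul, Matrix.transpose_one]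

/-- `H_μ` is a dominant Z-matrix for `μ > 0` (row sums `≥ μ`). [folklore] -/
theorem isDomZ_Hm {μ : ℝ} (hμ : 0 < μ) : IsDomZ (Hm n B μ) where
  offdiag x y hxy := by
    rw [Hm_apply, if_neg hxy]
    linarith [Sh_nonneg (n := n) (B := B) x y, Sh_nonneg (n := n) (B := B) y x]
  rowsum x := by
    have h' : ∑ y, Hm n B μ x y = (Hm n B μ).mulVec (fun _ => (1 : ℝ)) x := by
      simp only [Matrix.mulVec, dotProduct, mul_one]
    rw [h', Hm_mulVec]
    simp only [mul_one, one_mul]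
    by_cases hx : ι x = 0
    · rw [if_pos hx]
      have h1 : ∑ z, Sh n B z x = 0 := by
        have := sum_mul_Sh_of_first (y := x) (fun z h => by omega) (fun _ => (1 : ℝ))
        simpa only [one_mul] using this
      rw [h1]
      linarith [sum_Sh_row_le_one (n := n) (B := B) x]
    · rw [if_neg hx]
      linarith [sum_Sh_row_le_one (n := n) (B := B) x, sum_Sh_col_le_one (n := n) (B := B) x]

/-- the GREEN'S FUNCTION `G′_μ := H_μ⁻¹`. OURS (typing). [folklore] -/
def Gr (n B : ℕ) (μ : ℝ) : Matrix (Fin n × Fin B) (Fin n × Fin B) ℝ := (Hm n B μ)⁻¹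

/-- [folklore] -/
theorem Hm_mul_Gr {μ : ℝ} (hμ : 0 < μ) : Hm n B μ * Gr n B μ = 1 := (isDomZ_Hm hμ).mul_inv

/-- [folklore] -/
theorem Gr_mul_Hm {μ : ℝ} (hμ : 0 < μ) : Gr n B μ * Hm n B μ = 1 := (isDomZ_Hm hμ).inv_mul

/-- the Green's function is entrywise NON-NEGATIVE. [folklore] -/
theorem Gr_nonneg {μ : ℝ} (hμ : 0 < μ) (x y : Fin n × Fin B) : 0 ≤ Gr n B μ x y :=
  (isDomZ_Hm hμ).inv_nonneg x y

/-- the Green's function is symmetric. [folklore] -/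
theorem Gr_transpose (μ : ℝ) : (Gr n B μ).transpose = Gr n B μ := by
  unfold Gr; rw [Matrix.transpose_nonsing_inv, Hm_transpose]

end Helmholtz

/-! ## §3 The supersolution and the decay of the Green's function -/

section Decay

variable {n B : ℕ} {t μ : ℝ}

/-- the COMPARISON PROFILE centred at `b`: a decaying exponential plus its Neumann image
(`a ↦ e^{−t|a−b|} + e^{−t(a+b+1)}`, so that the virtual value at `a = −1` equals the value at `a = 0`).
OURS. [folklore] -/
def prof (t b a : ℝ) : ℝ := Real.exp (-(t * |a - b|)) + Real.exp (-(t * (a + b + 1)))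

/-- [folklore] -/
theorem prof_nonneg (t b a : ℝ) : 0 ≤ prof t b a := add_nonneg (Real.exp_nonneg _) (Real.exp_nonneg _)

/-- the Neumann reflection: the virtual value at `−1` is the value at `0`. [folklore] -/
theorem prof_neg_one (t : ℝ) {b : ℝ} (hb : 0 ≤ b) : prof t b (-1) = prof t b 0 := by
  unfold prof
  rw [show |(-1 : ℝ) - b| = b + 1 by rw [abs_of_nonpos (by linarith)]; ring,
    show |(0 : ℝ) - b| = b by rw [zero_sub, abs_neg, abs_of_nonneg hb], add_comm]
  congr 1 <;> (congr 1; ring)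

/-- the three-term identity of the exponential. [folklore] -/
theorem three_term (t c s : ℝ) :
    c * Real.exp (-(t * s)) - Real.exp (-(t * (s - 1))) - Real.exp (-(t * (s + 1)))
      = Real.exp (-(t * s)) * (c - Real.exp t - Real.exp (-t)) := by
  rw [show -(t * (s - 1)) = -(t * s) + t by ring, show -(t * (s + 1)) = -(t * s) + -t by ring,
    Real.exp_add, Real.exp_add]
  ring

/-- [folklore] -/
theorem three_term_nonneg (hq : Real.exp t + Real.exp (-t) ≤ 2 + μ) {s s₁ s₂ : ℝ} (h1 : s₁ = s - 1)
    (h2 : s₂ = s + 1) :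
    0 ≤ (2 + μ) * Real.exp (-(t * s)) - Real.exp (-(t * s₁)) - Real.exp (-(t * s₂)) := by
  subst h1 h2
  rw [three_term]
  exact mul_nonneg (Real.exp_nonneg _) (by linarith)

/-- [folklore] -/
theorem three_term_nonneg' (hq : Real.exp t + Real.exp (-t) ≤ 2 + μ) {s s₁ s₂ : ℝ} (h1 : s₁ = s + 1)
    (h2 : s₂ = s - 1) :
    0 ≤ (2 + μ) * Real.exp (-(t * s)) - Real.exp (-(t * s₁)) - Real.exp (-(t * s₂)) := by
  have := three_term_nonneg hq h2 h1
  linarith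

/-- the profile is a SUPERSOLUTION of the three-term recursion with a unit defect at the centre:
`(2+μ)F(a) − F(a−1) − F(a+1) ≥ [a = b]·(2 + μ − 2e^{−t})` for naturals `a, b`, provided
`cosh t ≤ 1 + μ/2`. [folklore] -/
theorem prof_three_term (hq : Real.exp t + Real.exp (-t) ≤ 2 + μ) (a b : ℕ) :
    (if a = b then 2 + μ - 2 * Real.exp (-t) else 0) ≤
      (2 + μ) * prof t b a - prof t b ((a : ℝ) - 1) - prof t b ((a : ℝ) + 1) := by
  have himg : 0 ≤ (2 + μ) * Real.exp (-(t * ((a : ℝ) + b + 1)))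
      - Real.exp (-(t * ((a : ℝ) - 1 + b + 1))) - Real.exp (-(t * ((a : ℝ) + 1 + b + 1))) :=
    three_term_nonneg hq (by ring) (by ring)
  have hsplit : (2 + μ) * prof t b a - prof t b ((a : ℝ) - 1) - prof t b ((a : ℝ) + 1)
      = ((2 + μ) * Real.exp (-(t * |(a : ℝ) - b|)) - Real.exp (-(t * |(a : ℝ) - 1 - b|))
          - Real.exp (-(t * |(a : ℝ) + 1 - b|)))
        + ((2 + μ) * Real.exp (-(t * ((a : ℝ) + b + 1))) - Real.exp (-(t * ((a : ℝ) - 1 + b + 1)))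
          - Real.exp (-(t * ((a : ℝ) + 1 + b + 1)))) := by
    unfold prof; ring
  rw [hsplit]
  rcases lt_trichotomy a b with hab | hab | hab
  · have h1 : (a : ℝ) + 1 ≤ b := by exact_mod_cast hab
    rw [if_neg (Nat.ne_of_lt hab), abs_of_nonpos (by linarith), abs_of_nonpos (by linarith),
      abs_of_nonpos (by linarith)]
    have hdir : 0 ≤ (2 + μ) * Real.exp (-(t * -((a : ℝ) - b))) - Real.exp (-(t * -((a : ℝ) - 1 - b)))
        - Real.exp (-(t * -((a : ℝ) + 1 - b))) :=
      three_term_nonneg' hq (by ring) (by ring)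
    linarith
  · subst hab
    rw [if_pos rfl, sub_self, abs_zero, mul_zero, neg_zero, Real.exp_zero,
      show (a : ℝ) - 1 - a = -1 by ring, show (a : ℝ) + 1 - a = 1 by ring, abs_neg, abs_one]
    simp only [mul_one]
    linarith
  · have h1 : (b : ℝ) + 1 ≤ a := by exact_mod_cast hab
    rw [if_neg (Nat.ne_of_gt hab), abs_of_nonneg (by linarith), abs_of_nonneg (by linarith),
      abs_of_nonneg (by linarith)]
    have hdir : 0 ≤ (2 + μ) * Real.exp (-(t * ((a : ℝ) - b))) - Real.exp (-(t * ((a : ℝ) - 1 - b)))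
        - Real.exp (-(t * ((a : ℝ) + 1 - b))) :=
      three_term_nonneg hq (by ring) (by ring)
    linarith

/-- the profile centred at `ι y`, read on the sites, is a SUPERSOLUTION of `H_μ` with defect
`≥ (2 + μ − 2e^{−t})·δ_{xy}` — at the Neumann end the image term makes the boundary row equal to the
interior three-term expression, at the Dirichlet end a non-negative term is dropped. [folklore] -/
theorem Hm_mulVec_prof (hq : Real.exp t + Real.exp (-t) ≤ 2 + μ) (y x : Fin n × Fin B) :
    (if x = y then 2 + μ - 2 * Real.exp (-t) else 0)
      ≤ (Hm n B μ).mulVec (fun z => prof t (ι y) (ι z)) x := by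
  rw [Hm_mulVec]
  have h3 := prof_three_term hq (ι x) (ι y)
  have hsucc : ∑ z, Sh n B x z * prof t (ι y) (ι z) ≤ prof t (ι y) ((ι x : ℝ) + 1) := by
    by_cases hx : ι x + 1 < n * B
    · obtain ⟨z, hz⟩ := exists_succ hx
      rw [sum_Sh_mul hz, hz]; push_cast; exact le_rfl
    · rw [sum_Sh_mul_of_last (fun z h => hx (h ▸ ι_lt z))]; exact prof_nonneg _ _ _
  have hpred : (if ι x = 0 then (1 : ℝ) else 0) * prof t (ι y) (ι x) + ∑ z, prof t (ι y) (ι z) * Sh n B z x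
      = prof t (ι y) ((ι x : ℝ) - 1) := by
    by_cases hx : ι x = 0
    · rw [if_pos hx, sum_mul_Sh_of_first (fun w h => by omega), hx]
      push_cast
      rw [one_mul, add_zero, zero_sub, prof_neg_one t (Nat.cast_nonneg _)]
    · obtain ⟨w, hw⟩ := exists_pred (Nat.pos_of_ne_zero hx)
      rw [if_neg hx, sum_mul_Sh hw, hw]
      push_cast
      rw [zero_mul, zero_add, add_sub_cancel_right]
  by_cases hxy : x = y
  · rw [if_pos hxy] at ⊢; rw [if_pos (ι_inj.2 hxy)] at h3; linarith
  · rw [if_neg hxy] at ⊢; rw [if_neg (mt ι_inj.1 hxy)] at h3; linarith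

/-- [folklore] -/
theorem defect_pos (hμ : 0 < μ) (ht : 0 ≤ t) : 0 < 2 + μ - 2 * Real.exp (-t) := by
  have : Real.exp (-t) ≤ 1 := by rw [← Real.exp_zero]; exact Real.exp_le_exp.mpr (by linarith)
  linarith

/-- COMPARISON BOUND: `G′_μ(x,y) ≤ F_{ι y}(ι x)/(2 + μ − 2e^{−t})`. [folklore] -/
theorem Gr_le_prof (hμ : 0 < μ) (ht : 0 ≤ t) (hq : Real.exp t + Real.exp (-t) ≤ 2 + μ)
    (x y : Fin n × Fin B) :
    Gr n B μ x y ≤ (2 + μ - 2 * Real.exp (-t))⁻¹ * prof t (ι y) (ι x) := by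
  have hK := defect_pos hμ ht
  refine (isDomZ_Hm hμ).inv_le_of_supersol y
    (φ := fun z => (2 + μ - 2 * Real.exp (-t))⁻¹ * prof t (ι y) (ι z)) (fun i => ?_) x
  have hm : (Hm n B μ).mulVec (fun z => (2 + μ - 2 * Real.exp (-t))⁻¹ * prof t (ι y) (ι z)) i
      = (2 + μ - 2 * Real.exp (-t))⁻¹ * (Hm n B μ).mulVec (fun z => prof t (ι y) (ι z)) i := by
    have : (fun z : Fin n × Fin B => (2 + μ - 2 * Real.exp (-t))⁻¹ * prof t (ι y) (ι z))
        = (2 + μ - 2 * Real.exp (-t))⁻¹ • fun z : Fin n × Fin B => prof t (ι y) (ι z) := rfl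
    rw [this, Matrix.mulVec_smul, Pi.smul_apply, smul_eq_mul]
  rw [hm]
  have h3 := Hm_mulVec_prof (n := n) (B := B) hq y i
  by_cases hiy : i = y
  · rw [if_pos hiy] at h3 ⊢
    calc (1 : ℝ) = (2 + μ - 2 * Real.exp (-t))⁻¹ * (2 + μ - 2 * Real.exp (-t)) :=
          (inv_mul_cancel₀ hK.ne').symm
      _ ≤ _ := mul_le_mul_of_nonneg_left h3 (inv_nonneg.mpr hK.le)
  · rw [if_neg hiy] at h3 ⊢
    exact mul_nonneg (inv_nonneg.mpr hK.le) h3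

/-- [folklore] -/
theorem prof_le (ht : 0 ≤ t) {a b : ℝ} (ha : 0 ≤ a) (hb : 0 ≤ b) :
    prof t b a ≤ 2 * Real.exp (-(t * |a - b|)) := by
  unfold prof
  have h1 : |a - b| ≤ a + b + 1 := abs_le.mpr ⟨by linarith, by linarith⟩
  have h2 : Real.exp (-(t * (a + b + 1))) ≤ Real.exp (-(t * |a - b|)) :=
    Real.exp_le_exp.mpr (by nlinarith [mul_le_mul_of_nonneg_left h1 ht])
  linarith

/-- MAIN ESTIMATE (site form): for `μ > 0`, `t ≥ 0` with `cosh t ≤ 1 + μ/2`,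
`0 ≤ G′_μ(x, y) ≤ 2(2 + μ − 2e^{−t})⁻¹ · e^{−t|ι x − ι y|}`. [folklore] -/
theorem Gr_le (hμ : 0 < μ) (ht : 0 ≤ t) (hq : Real.exp t + Real.exp (-t) ≤ 2 + μ)
    (x y : Fin n × Fin B) :
    Gr n B μ x y ≤ 2 * (2 + μ - 2 * Real.exp (-t))⁻¹ * Real.exp (-(t * |(ι x : ℝ) - ι y|)) := by
  have hK := defect_pos hμ ht
  calc Gr n B μ x y ≤ (2 + μ - 2 * Real.exp (-t))⁻¹ * prof t (ι y) (ι x) := Gr_le_prof hμ ht hq x y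
    _ ≤ (2 + μ - 2 * Real.exp (-t))⁻¹ * (2 * Real.exp (-(t * |(ι x : ℝ) - ι y|))) :=
        mul_le_mul_of_nonneg_left (prof_le ht (Nat.cast_nonneg _) (Nat.cast_nonneg _))
          (inv_nonneg.mpr hK.le)
    _ = _ := by ring

end Decay

/-! ## §4 The mass `m`: `μ = m²`, `t = m/2` -/

section Mass

variable {n B : ℕ} {m : ℝ}

/-- `cosh(m/2) ≤ 1 + m²/2` for `0 ≤ m ≤ 1` (crudely, from `|e^s − 1 − s| ≤ s²` for `|s| ≤ 1`). [folklore] -/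
theorem cosh_half_le (hm0 : 0 ≤ m) (hm1 : m ≤ 1) :
    Real.exp (m / 2) + Real.exp (-(m / 2)) ≤ 2 + m ^ 2 := by
  have h1 := Real.abs_exp_sub_one_sub_id_le (x := m / 2) (by rw [abs_of_nonneg (by linarith)]; linarith)
  have h2 := Real.abs_exp_sub_one_sub_id_le (x := -(m / 2))
    (by rw [abs_neg, abs_of_nonneg (by linarith)]; linarith)
  have h1' := (abs_le.mp h1).2
  have h2' := (abs_le.mp h2).2
  nlinarith

/-- the defect at `μ = m²`, `t = m/2` is `≥ m/2` for `0 ≤ m ≤ 1`. [folklore] -/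
theorem half_le_defect (hm0 : 0 ≤ m) (hm1 : m ≤ 1) : m / 2 ≤ 2 + m ^ 2 - 2 * Real.exp (-(m / 2)) := by
  have h2 := Real.abs_exp_sub_one_sub_id_le (x := -(m / 2))
    (by rw [abs_neg, abs_of_nonneg (by linarith)]; linarith)
  have h2' := (abs_le.mp h2).2
  nlinarith

/-- MAIN ESTIMATE AT MASS `m`: `0 ≤ G′_{m²}(x, y) ≤ (4/m)·e^{−(m/2)|ι x − ι y|}` for `0 < m ≤ 1`. [folklore] -/
theorem Gr_mass_le (hm0 : 0 < m) (hm1 : m ≤ 1) (x y : Fin n × Fin B) :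
    Gr n B (m ^ 2) x y ≤ 4 / m * Real.exp (-(m / 2 * |(ι x : ℝ) - ι y|)) := by
  have hμ : 0 < m ^ 2 := by positivity
  have h := Gr_le (n := n) (B := B) hμ (by linarith : 0 ≤ m / 2) (cosh_half_le hm0.le hm1) x y
  have hd := half_le_defect hm0.le hm1
  have hK : 0 < 2 + m ^ 2 - 2 * Real.exp (-(m / 2)) := by linarith
  have hinv : (2 + m ^ 2 - 2 * Real.exp (-(m / 2)))⁻¹ ≤ 2 / m := by
    rw [show (2 : ℝ) / m = (m / 2)⁻¹ by rw [inv_div]]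
    exact inv_anti₀ (by linarith) hd
  calc Gr n B (m ^ 2) x y ≤ 2 * (2 + m ^ 2 - 2 * Real.exp (-(m / 2)))⁻¹
        * Real.exp (-(m / 2 * |(ι x : ℝ) - ι y|)) := h
    _ ≤ 2 * (2 / m) * Real.exp (-(m / 2 * |(ι x : ℝ) - ι y|)) :=
        mul_le_mul_of_nonneg_right (mul_le_mul_of_nonneg_left hinv (by norm_num)) (Real.exp_nonneg _)
    _ = _ := by ring

end Mass

/-! ## §5 The block form: `G′ ∈ 𝒟(0, 2, c)` on the toy frame with a `B`-free `c` -/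

section Block

variable {n B : ℕ} {N : Finset (Fin n)} {hN : N.Nonempty} {δ₀ : ℝ}

/-- sites of blocks `I, J` have linear indices at distance `≥ B(|I−J| − 1)`. [folklore] -/
theorem dι_ge (x y : Fin n × Fin B) :
    (B : ℝ) * (bdist n x.1 y.1 - 1) ≤ |(ι x : ℝ) - ι y| := by
  have hx : (ι x : ℝ) = x.2.val + (B : ℝ) * x.1.val := by rw [ι_eq]; push_cast; ring
  have hy : (ι y : ℝ) = y.2.val + (B : ℝ) * y.1.val := by rw [ι_eq]; push_cast; ring
  have hx2 : (x.2.val : ℝ) + 1 ≤ B := by exact_mod_cast x.2.isLt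
  have hy2 : (y.2.val : ℝ) + 1 ≤ B := by exact_mod_cast y.2.isLt
  have hx0 : (0 : ℝ) ≤ x.2.val := Nat.cast_nonneg _
  have hy0 : (0 : ℝ) ≤ y.2.val := Nat.cast_nonneg _
  have ho : |(x.2.val : ℝ) - y.2.val| ≤ (B : ℝ) - 1 := abs_le.mpr ⟨by linarith, by linarith⟩
  have hB0 : (0 : ℝ) ≤ B := Nat.cast_nonneg _
  have h1 := abs_sub_abs_le_abs_sub ((B : ℝ) * ((x.1.val : ℝ) - y.1.val)) (-((x.2.val : ℝ) - y.2.val))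
  rw [abs_neg, abs_mul, abs_of_nonneg hB0] at h1
  unfold bdist
  rw [hx, hy, show (x.2.val : ℝ) + (B : ℝ) * x.1.val - (y.2.val + (B : ℝ) * y.1.val)
      = (B : ℝ) * ((x.1.val : ℝ) - y.1.val) - (-((x.2.val : ℝ) - y.2.val)) by ring]
  nlinarith [abs_nonneg ((x.1.val : ℝ) - y.1.val)]

/-- the per-site decay factor inside a block pair: at `m = 1/B`,
`e^{−|ι x − ι y|/(2B)} ≤ e^{1/2}·e^{−|I−J|/2}`. [folklore] -/
theorem site_factor_le (hB : 0 < B) (x y : Fin n × Fin B) :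
    Real.exp (-((B : ℝ)⁻¹ / 2 * |(ι x : ℝ) - ι y|))
      ≤ Real.exp (1 / 2) * Real.exp (-(1 / 2 * bdist n x.1 y.1)) := by
  rw [← Real.exp_add]
  apply Real.exp_le_exp.mpr
  have hB' : (0 : ℝ) < B := by exact_mod_cast hB
  have h := dι_ge x y
  have h2 : (B : ℝ)⁻¹ * |(ι x : ℝ) - ι y| ≥ bdist n x.1 y.1 - 1 := by
    rw [ge_iff_le, ← inv_mul_cancel_left₀ hB'.ne' (bdist n x.1 y.1 - 1)]
    exact mul_le_mul_of_nonneg_left h (inv_nonneg.mpr hB'.le)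
  nlinarith

/-- a block has `B` sites. [folklore] -/
theorem card_block_le (J : Fin n) : (univ.filter (fun y : Fin n × Fin B => y.1 = J)).card ≤ B := by
  calc (univ.filter (fun y : Fin n × Fin B => y.1 = J)).card
      ≤ (univ.image (fun b : Fin B => ((J, b) : Fin n × Fin B))).card := by
        refine card_le_card fun y hy => ?_
        rw [mem_filter] at hy
        exact mem_image.mpr ⟨y.2, mem_univ _, by rw [← hy.2]⟩
    _ ≤ (univ : Finset (Fin B)).card := card_image_le
    _ = B := by rw [card_univ, Fintype.card_fin]

/-- block row sums of the Green's function at mass `1/B`. [folklore] -/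
theorem Gr_block_rowsum (hB : 0 < B) (x : Fin n × Fin B) (J : Fin n) :
    ∑ y ∈ univ.filter (fun y : Fin n × Fin B => y.1 = J), |Gr n B (((B : ℝ)⁻¹) ^ 2) x y|
      ≤ 4 * Real.exp (1 / 2) * (B : ℝ) ^ 2 * Real.exp (-(1 / 2 * bdist n x.1 J)) := by
  have hB' : (0 : ℝ) < B := by exact_mod_cast hB
  have hB1 : (1 : ℝ) ≤ B := by exact_mod_cast hB
  have hm0 : (0 : ℝ) < (B : ℝ)⁻¹ := inv_pos.mpr hB'
  have hm1 : (B : ℝ)⁻¹ ≤ 1 := inv_le_one_of_one_le₀ hB1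
  have hμ : (0 : ℝ) < ((B : ℝ)⁻¹) ^ 2 := by positivity
  have hterm : ∀ y ∈ univ.filter (fun y : Fin n × Fin B => y.1 = J),
      |Gr n B (((B : ℝ)⁻¹) ^ 2) x y| ≤ 4 * (B : ℝ) * (Real.exp (1 / 2) * Real.exp (-(1 / 2 * bdist n x.1 J))) := by
    intro y hy
    rw [mem_filter] at hy
    rw [abs_of_nonneg (Gr_nonneg hμ x y), ← hy.2]
    calc Gr n B (((B : ℝ)⁻¹) ^ 2) x y ≤ 4 / (B : ℝ)⁻¹ * Real.exp (-((B : ℝ)⁻¹ / 2 * |(ι x : ℝ) - ι y|)) :=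
          Gr_mass_le hm0 hm1 x y
      _ ≤ 4 / (B : ℝ)⁻¹ * (Real.exp (1 / 2) * Real.exp (-(1 / 2 * bdist n x.1 y.1))) :=
          mul_le_mul_of_nonneg_left (site_factor_le hB x y) (by positivity)
      _ = 4 * (B : ℝ) * (Real.exp (1 / 2) * Real.exp (-(1 / 2 * bdist n x.1 y.1))) := by
          rw [div_inv_eq_mul]
  have hcard := card_block_le (n := n) (B := B) J
  calc ∑ y ∈ univ.filter (fun y : Fin n × Fin B => y.1 = J), |Gr n B (((B : ℝ)⁻¹) ^ 2) x y|
      ≤ ∑ y ∈ univ.filter (fun y : Fin n × Fin B => y.1 = J),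
          4 * (B : ℝ) * (Real.exp (1 / 2) * Real.exp (-(1 / 2 * bdist n x.1 J))) := sum_le_sum hterm
    _ = (univ.filter (fun y : Fin n × Fin B => y.1 = J)).card
          * (4 * (B : ℝ) * (Real.exp (1 / 2) * Real.exp (-(1 / 2 * bdist n x.1 J)))) := by
        rw [sum_const, nsmul_eq_mul]
    _ ≤ (B : ℝ) * (4 * (B : ℝ) * (Real.exp (1 / 2) * Real.exp (-(1 / 2 * bdist n x.1 J)))) :=
        mul_le_mul_of_nonneg_right (by exact_mod_cast hcard) (by positivity)
    _ = _ := by ring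

/-- THE `(M)`-FIELD SHAPE WITH A `B`-FREE CONSTANT: at mass `1/B` (one inverse block) the Green's function
`G′ = (∂*∂ + B⁻²)⁻¹` of the toy belongs to `𝒟(0, 2, 4e^{1/2})` on the toy frame (block maps = the block
index, scale `B`, class `k = 2`), for any decay-rate parameter `δ₀ ≤ 1/2` of the frame. [folklore] -/
theorem Gr_opDec (hB : 0 < B) (hδ : δ₀ ≤ 1 / 2) :
    OpDec (toyFrame n B N hN δ₀) Prod.fst Prod.fst id id 0 2 (4 * Real.exp (1 / 2))
      (Gr n B (((B : ℝ)⁻¹) ^ 2)) := by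
  refine ⟨fun I J => 4 * Real.exp (1 / 2) * (B : ℝ) ^ 2 * Real.exp (-(δ₀ * bdist n I J)), ⟨?_, ?_⟩, ?_⟩
  · intro I J; positivity
  · intro x J
    refine (Gr_block_rowsum hB x J).trans ?_
    refine mul_le_mul_of_nonneg_left (Real.exp_le_exp.mpr ?_) (by positivity)
    nlinarith [bdist_nonneg (n := n) x.1 J]
  · intro I J
    simp only [toyFrame_ρ, toyFrame_sc, Frame.rate_zero, toyFrame_δ₀, id]
    rw [abs_of_nonneg (by positivity)]
    norm_cast

end Block

/-! ## §6 The gradient: unimodal columns and the class `∂G′ ∈ 𝒟(0, 1, c)` -/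

section Gradient

variable {n B : ℕ} {μ : ℝ}

/-- [folklore] -/
theorem site_ι (x : Fin n × Fin B) : site (ι x) (ι_lt x) = x := ι_injective (ι_site _ _)

/-- the column `y` of the Green's function as a function of the linear index, extended by `0` beyond
the last site (the value at the virtual Dirichlet site). OURS. [folklore] -/
def U (n B : ℕ) (μ : ℝ) (y : Fin n × Fin B) (i : ℕ) : ℝ :=
  if h : i < n * B then Gr n B μ (site i h) y else 0

variable (y : Fin n × Fin B)

/-- [folklore] -/
theorem U_ι (x : Fin n × Fin B) : U n B μ y (ι x) = Gr n B μ x y := by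
  unfold U; rw [dif_pos (ι_lt x), site_ι]

/-- [folklore] -/
theorem U_site {i : ℕ} (hi : i < n * B) : U n B μ y i = Gr n B μ (site i hi) y := by
  unfold U; rw [dif_pos hi]

/-- [folklore] -/
theorem U_of_le {i : ℕ} (hi : n * B ≤ i) : U n B μ y i = 0 := by
  unfold U; rw [dif_neg (not_lt.mpr hi)]

/-- [folklore] -/
theorem U_nonneg (hμ : 0 < μ) (i : ℕ) : 0 ≤ U n B μ y i := by
  unfold U
  split_ifs
  · exact Gr_nonneg hμ _ _
  · exact le_rfl

/-- [folklore] -/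
theorem sum_Sh_Gr (x : Fin n × Fin B) : ∑ z, Sh n B x z * Gr n B μ z y = U n B μ y (ι x + 1) := by
  by_cases hx : ι x + 1 < n * B
  · obtain ⟨z, hz⟩ := exists_succ hx
    rw [sum_Sh_mul hz, ← U_ι y z, hz]
  · rw [sum_Sh_mul_of_last (fun z h' => hx (h' ▸ ι_lt z)), U_of_le y (not_lt.mp hx)]

/-- [folklore] -/
theorem sum_Gr_Sh (x : Fin n × Fin B) :
    ∑ z, Gr n B μ z y * Sh n B z x = if ι x = 0 then (0 : ℝ) else U n B μ y (ι x - 1) := by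
  by_cases hx : ι x = 0
  · rw [if_pos hx, sum_mul_Sh_of_first (fun w h' => by omega)]
  · obtain ⟨w, hw⟩ := exists_pred (Nat.pos_of_ne_zero hx)
    rw [if_neg hx, sum_mul_Sh hw, ← U_ι y w, hw, Nat.add_sub_cancel]

/-- the forward difference of the Green's function in the first variable. [folklore] -/
theorem DGr_apply (x : Fin n × Fin B) :
    (Dfw n B * Gr n B μ) x y = U n B μ y (ι x + 1) - U n B μ y (ι x) := by
  unfold Dfw
  rw [Matrix.sub_mul, Matrix.one_mul, Matrix.sub_apply, Matrix.mul_apply, sum_Sh_Gr, U_ι]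

/-- the ROW EQUATIONS `H_μG′ = 1` read through the linear index. [folklore] -/
theorem row_eq (hμ : 0 < μ) (x : Fin n × Fin B) :
    (2 + μ) * U n B μ y (ι x) - (if ι x = 0 then (1 : ℝ) else 0) * U n B μ y (ι x)
      - U n B μ y (ι x + 1) - (if ι x = 0 then (0 : ℝ) else U n B μ y (ι x - 1))
      = if x = y then 1 else 0 := by
  have h := mulVec_col_apply (Hm n B μ) (Gr n B μ) x y
  rw [Hm_mul_Gr hμ, Matrix.one_apply, Hm_mulVec, sum_Sh_Gr, sum_Gr_Sh, ← U_ι y x] at h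
  exact h

variable {y}

/-- interior (and last-site) rows away from the source: `(2+μ)U(i) = U(i+1) + U(i−1)`. [folklore] -/
theorem rec_int (hμ : 0 < μ) {i : ℕ} (hi0 : i ≠ 0) (hiL : i < n * B) (hib : i ≠ ι y) :
    (2 + μ) * U n B μ y i = U n B μ y (i + 1) + U n B μ y (i - 1) := by
  have h := row_eq y hμ (site i hiL)
  rw [ι_site, if_neg hi0, if_neg hi0, if_neg (fun h' => hib (by rw [← h', ι_site]))] at h
  linarith

/-- the first (Neumann) row away from the source: `(1+μ)U(0) = U(1)`. [folklore] -/
theorem rec_zero (hμ : 0 < μ) (hL : 0 < n * B) (hb : ι y ≠ 0) :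
    (1 + μ) * U n B μ y 0 = U n B μ y 1 := by
  have h := row_eq y hμ (site 0 hL)
  rw [ι_site, if_pos rfl, if_pos rfl, zero_add, if_neg (fun h' => hb (by rw [← h', ι_site]))] at h
  linarith

/-- the source row (interior source). [folklore] -/
theorem src_int (hμ : 0 < μ) (hb : ι y ≠ 0) :
    (2 + μ) * U n B μ y (ι y) = U n B μ y (ι y + 1) + U n B μ y (ι y - 1) + 1 := by
  have h := row_eq y hμ y
  rw [if_neg hb, if_neg hb, if_pos rfl] at h
  linarith

/-- the source row (source at the first site). [folklore] -/
theorem src_zero (hμ : 0 < μ) (hb : ι y = 0) : (1 + μ) * U n B μ y 0 = U n B μ y 1 + 1 := by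
  have h := row_eq y hμ y
  rw [hb, if_pos rfl, if_pos rfl, zero_add, if_pos rfl] at h
  linarith

/-- LEFT OF THE SOURCE: `W(0) = μU(0)` for the forward difference `W(i) := U(i+1) − U(i)`. [folklore] -/
theorem W_zero (hμ : 0 < μ) (hb : 0 < ι y) : U n B μ y 1 - U n B μ y 0 = μ * U n B μ y 0 := by
  have := rec_zero (y := y) hμ (lt_of_le_of_lt (Nat.zero_le _) (ι_lt y)) hb.ne'
  linarith

/-- LEFT OF THE SOURCE: `W(i+1) = W(i) + μU(i+1)`. [folklore] -/
theorem W_succ (hμ : 0 < μ) {i : ℕ} (hib : i + 1 < ι y) :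
    U n B μ y (i + 1 + 1) - U n B μ y (i + 1)
      = (U n B μ y (i + 1) - U n B μ y i) + μ * U n B μ y (i + 1) := by
  have := rec_int (y := y) hμ (by omega : i + 1 ≠ 0) (lt_trans hib (ι_lt y)) (Nat.ne_of_lt hib)
  rw [Nat.add_sub_cancel] at this
  linarith

/-- the column INCREASES up to the source. [folklore] -/
theorem W_nonneg (hμ : 0 < μ) : ∀ i, i < ι y → 0 ≤ U n B μ y (i + 1) - U n B μ y i
  | 0, h => by rw [W_zero hμ h]; exact mul_nonneg hμ.le (U_nonneg y hμ 0)
  | i + 1, h => by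
      rw [W_succ hμ h]
      exact add_nonneg (W_nonneg hμ i (by omega)) (mul_nonneg hμ.le (U_nonneg y hμ _))

/-- [folklore] -/
theorem W_le_succ (hμ : 0 < μ) {i : ℕ} (h : i + 1 < ι y) :
    U n B μ y (i + 1) - U n B μ y i ≤ U n B μ y (i + 1 + 1) - U n B μ y (i + 1) := by
  rw [W_succ hμ h]; linarith [mul_nonneg hμ.le (U_nonneg y hμ (i + 1))]

/-- the forward differences are NON-DECREASING left of the source (discrete convexity). [folklore] -/
theorem W_mono (hμ : 0 < μ) {i j : ℕ} (hij : i ≤ j) (hj : j < ι y) :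
    U n B μ y (i + 1) - U n B μ y i ≤ U n B μ y (j + 1) - U n B μ y j := by
  induction j, hij using Nat.le_induction with
  | base => exact le_rfl
  | succ k hik ih => exact (ih (by omega)).trans (W_le_succ hμ hj)

/-- RIGHT OF THE SOURCE: `D(a) = D(a+1) + μU(a+1)` for the drop `D(a) := U(a) − U(a+1)`. [folklore] -/
theorem D_succ (hμ : 0 < μ) {a : ℕ} (hba : ι y ≤ a) (haL : a + 1 < n * B) :
    U n B μ y a - U n B μ y (a + 1)
      = (U n B μ y (a + 1) - U n B μ y (a + 1 + 1)) + μ * U n B μ y (a + 1) := by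
  have := rec_int (y := y) hμ (by omega : a + 1 ≠ 0) haL (by omega : a + 1 ≠ ι y)
  rw [Nat.add_sub_cancel] at this
  linarith

/-- [folklore] -/
theorem D_nonneg_aux (hμ : 0 < μ) :
    ∀ d a, n * B ≤ a + 1 + d → ι y ≤ a → 0 ≤ U n B μ y a - U n B μ y (a + 1)
  | 0, a, h, _ => by
      rw [U_of_le y (by omega : n * B ≤ a + 1), sub_zero]; exact U_nonneg y hμ a
  | d + 1, a, h, hba => by
      by_cases haL : a + 1 < n * B
      · rw [D_succ hμ hba haL]
        exact add_nonneg (D_nonneg_aux hμ d (a + 1) (by omega) (by omega))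
          (mul_nonneg hμ.le (U_nonneg y hμ _))
      · rw [U_of_le y (not_lt.mp haL), sub_zero]; exact U_nonneg y hμ a

/-- the column DECREASES from the source to the Dirichlet end. [folklore] -/
theorem D_nonneg (hμ : 0 < μ) {a : ℕ} (hba : ι y ≤ a) : 0 ≤ U n B μ y a - U n B μ y (a + 1) :=
  D_nonneg_aux hμ (n * B) a (by omega) hba

/-- [folklore] -/
theorem D_succ_le (hμ : 0 < μ) {a : ℕ} (hba : ι y ≤ a) :
    U n B μ y (a + 1) - U n B μ y (a + 1 + 1) ≤ U n B μ y a - U n B μ y (a + 1) := by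
  by_cases haL : a + 1 < n * B
  · rw [D_succ hμ hba haL]; linarith [mul_nonneg hμ.le (U_nonneg y hμ (a + 1))]
  · rw [U_of_le y (not_lt.mp haL), U_of_le y (by omega : n * B ≤ a + 1 + 1), sub_zero, sub_zero]
    exact U_nonneg y hμ a

/-- the drops are NON-INCREASING right of the source (discrete convexity). [folklore] -/
theorem D_anti (hμ : 0 < μ) {a c : ℕ} (hba : ι y ≤ a) (hac : a ≤ c) :
    U n B μ y c - U n B μ y (c + 1) ≤ U n B μ y a - U n B μ y (a + 1) := by
  induction c, hac using Nat.le_induction with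
  | base => exact le_rfl
  | succ k hak ih => exact (D_succ_le hμ (hba.trans hak)).trans ih

/-- at the source the drop to the right is `≤ 1`. [folklore] -/
theorem D_src_le_one (hμ : 0 < μ) : U n B μ y (ι y) - U n B μ y (ι y + 1) ≤ 1 := by
  by_cases hb : ι y = 0
  · have h := src_zero hμ hb
    rw [hb]
    linarith [mul_nonneg hμ.le (U_nonneg y hμ 0)]
  · have h := src_int hμ hb
    have hw := W_nonneg (y := y) hμ (ι y - 1) (by omega)
    rw [Nat.sub_add_cancel (Nat.pos_of_ne_zero hb)] at hw
    linarith [mul_nonneg hμ.le (U_nonneg y hμ (ι y))]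

/-- at the source the rise from the left is `≤ 1`. [folklore] -/
theorem W_src_le_one (hμ : 0 < μ) (hb : ι y ≠ 0) : U n B μ y (ι y) - U n B μ y (ι y - 1) ≤ 1 := by
  have h := src_int hμ hb
  have hd := D_nonneg (y := y) hμ (le_refl (ι y))
  linarith [mul_nonneg hμ.le (U_nonneg y hμ (ι y))]

/-- UNIMODALITY WITH UNIT JUMPS: every forward difference of a column is `≤ 1` in size (the flanks are
monotone towards the source, where the rise and the drop are `≤ 1`). [folklore] -/
theorem absW_le_one (hμ : 0 < μ) (i : ℕ) : |U n B μ y (i + 1) - U n B μ y i| ≤ 1 := by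
  rcases lt_trichotomy i (ι y) with hib | hib | hib
  · rw [abs_of_nonneg (W_nonneg (y := y) hμ i hib)]
    have h1 := W_mono (y := y) hμ (by omega : i ≤ ι y - 1) (by omega)
    have h2 := W_src_le_one (y := y) hμ (by omega)
    rw [Nat.sub_add_cancel (by omega : 1 ≤ ι y)] at h1
    linarith
  · subst hib
    rw [abs_sub_comm, abs_of_nonneg (D_nonneg (y := y) hμ (le_refl _))]
    exact D_src_le_one hμ
  · rw [abs_sub_comm, abs_of_nonneg (D_nonneg (y := y) hμ (le_of_lt hib))]
    exact (D_anti (y := y) hμ (le_refl _) (le_of_lt hib)).trans (D_src_le_one hμ)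

/-- UNIMODALITY in matrix form, left of the source: `G′(x, y) ≤ G′(x⁺, y)` for `ι x⁺ = ι x + 1 ≤ ι y`.
[folklore] -/
theorem Gr_le_Gr_succ (hμ : 0 < μ) {x x' y : Fin n × Fin B} (h : ι x' = ι x + 1) (hle : ι x' ≤ ι y) :
    Gr n B μ x y ≤ Gr n B μ x' y := by
  have := W_nonneg (y := y) hμ (ι x) (by omega)
  rwa [← h, U_ι, U_ι, sub_nonneg] at this

/-- UNIMODALITY in matrix form, right of the source: `G′(x⁺, y) ≤ G′(x, y)` for `ι y ≤ ι x`, `ι x⁺ = ι x + 1`.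
[folklore] -/
theorem Gr_succ_le_Gr (hμ : 0 < μ) {x x' y : Fin n × Fin B} (h : ι x' = ι x + 1) (hle : ι y ≤ ι x) :
    Gr n B μ x' y ≤ Gr n B μ x y := by
  have := D_nonneg (y := y) hμ hle
  rwa [← h, U_ι, U_ι, sub_nonneg] at this

/-- TELESCOPING LEFT: `(k+1)·W(i) ≤ U(i+k+1)` when `i+k` is still left of the source. [folklore] -/
theorem W_tele (hμ : 0 < μ) {i k : ℕ} (hik : i + k < ι y) :
    ((k : ℝ) + 1) * (U n B μ y (i + 1) - U n B μ y i) ≤ U n B μ y (i + k + 1) := by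
  have htel : ∑ j ∈ range (k + 1), (U n B μ y (i + j + 1) - U n B μ y (i + j))
      = U n B μ y (i + k + 1) - U n B μ y i := by
    have := Finset.sum_range_sub (fun j => U n B μ y (i + j)) (k + 1)
    simpa only [add_zero, ← add_assoc] using this
  have hlow : ∑ j ∈ range (k + 1), (U n B μ y (i + 1) - U n B μ y i)
      ≤ ∑ j ∈ range (k + 1), (U n B μ y (i + j + 1) - U n B μ y (i + j)) :=
    sum_le_sum fun j hj => W_mono hμ (Nat.le_add_right i j) (by have := mem_range.mp hj; omega)
  rw [sum_const, card_range, nsmul_eq_mul, htel] at hlow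
  push_cast at hlow
  linarith [U_nonneg y hμ i]

/-- TELESCOPING RIGHT: `(k+1)·D(a₀+k) ≤ U(a₀)` when `a₀` is right of (or at) the source. [folklore] -/
theorem D_tele (hμ : 0 < μ) {a₀ k : ℕ} (h : ι y ≤ a₀) :
    ((k : ℝ) + 1) * (U n B μ y (a₀ + k) - U n B μ y (a₀ + k + 1)) ≤ U n B μ y a₀ := by
  have htel : ∑ l ∈ range (k + 1), (U n B μ y (a₀ + l) - U n B μ y (a₀ + l + 1))
      = U n B μ y a₀ - U n B μ y (a₀ + k + 1) := by
    have := Finset.sum_range_sub' (fun l => U n B μ y (a₀ + l)) (k + 1)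
    simpa only [add_zero, ← add_assoc] using this
  have hlow : ∑ l ∈ range (k + 1), (U n B μ y (a₀ + k) - U n B μ y (a₀ + k + 1))
      ≤ ∑ l ∈ range (k + 1), (U n B μ y (a₀ + l) - U n B μ y (a₀ + l + 1)) :=
    sum_le_sum fun l hl => D_anti hμ (by omega : ι y ≤ a₀ + l) (by have := mem_range.mp hl; omega)
  rw [sum_const, card_range, nsmul_eq_mul, htel] at hlow
  push_cast at hlow
  linarith [U_nonneg y hμ (a₀ + k + 1)]

variable {m : ℝ}

/-- the decay bound of §4 on the extended column. [folklore] -/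
theorem U_le (hm0 : 0 < m) (hm1 : m ≤ 1) (i : ℕ) :
    U n B (m ^ 2) y i ≤ 4 / m * Real.exp (-(m / 2 * |(i : ℝ) - ι y|)) := by
  by_cases hi : i < n * B
  · rw [U_site y hi]
    have := Gr_mass_le hm0 hm1 (site i hi) y
    rwa [ι_site] at this
  · rw [U_of_le y (not_lt.mp hi)]; positivity

/-- GRADIENT ESTIMATE on the extended column at mass `1/B`: `|W(i)| ≤ 4e^{1/2}·e^{−|i − ι y|/(2B)}`
(unimodality + telescoping over a block length + the decay of `U`). [folklore] -/
theorem absW_le (hB : 0 < B) (i : ℕ) :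
    |U n B ((B : ℝ)⁻¹ ^ 2) y (i + 1) - U n B ((B : ℝ)⁻¹ ^ 2) y i|
      ≤ 4 * Real.exp (1 / 2) * Real.exp (-((B : ℝ)⁻¹ / 2 * |(i : ℝ) - ι y|)) := by
  have hB' : (0 : ℝ) < B := by exact_mod_cast hB
  have hm0 : (0 : ℝ) < (B : ℝ)⁻¹ := inv_pos.mpr hB'
  have hm1 : (B : ℝ)⁻¹ ≤ 1 := inv_le_one_of_one_le₀ (by exact_mod_cast hB)
  have hμ : (0 : ℝ) < (B : ℝ)⁻¹ ^ 2 := by positivity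
  have hmB : (B : ℝ)⁻¹ * B = 1 := inv_mul_cancel₀ hB'.ne'
  have h4 : (4 : ℝ) / (B : ℝ)⁻¹ = 4 * B := by rw [div_inv_eq_mul]
  have hcast : (((B - 1 : ℕ) : ℝ) + 1) = B := by
    rw [Nat.cast_sub (by omega : 1 ≤ B)]; push_cast; ring
  have he1 : (1 : ℝ) ≤ Real.exp (1 / 2) := by
    have := Real.add_one_le_exp (1 / 2 : ℝ); linarith
  -- the crude case: a difference `≤ 1` at distance `< B`
  have hnear : ∀ d : ℝ, 0 ≤ d → d < B → (1 : ℝ) ≤ 4 * Real.exp (1 / 2) * Real.exp (-((B : ℝ)⁻¹ / 2 * d)) := by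
    intro d hd0 hdB
    have h2 : Real.exp (-(1 / 2 : ℝ)) ≤ Real.exp (-((B : ℝ)⁻¹ / 2 * d)) := by
      apply Real.exp_le_exp.mpr
      have : (B : ℝ)⁻¹ * d ≤ 1 := by
        rw [inv_mul_le_iff₀ hB']; linarith
      linarith
    have h3 : Real.exp (1 / 2) * Real.exp (-(1 / 2 : ℝ)) = 1 := by
      rw [← Real.exp_add]; norm_num
    nlinarith [Real.exp_pos (1 / 2 : ℝ), Real.exp_pos (-((B : ℝ)⁻¹ / 2 * d)),
      mul_le_mul_of_nonneg_left h2 (Real.exp_pos (1 / 2 : ℝ)).le]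
  rcases lt_trichotomy i (ι y) with hib | hib | hib
  · -- left of the source
    have hW0 := W_nonneg (y := y) hμ i hib
    have hlt : (i : ℝ) < ι y := by exact_mod_cast hib
    have habs' : |(i : ℝ) - ι y| = (ι y : ℝ) - i := by
      rw [abs_of_nonpos (by linarith)]; ring
    rw [abs_of_nonneg hW0, habs']
    by_cases hd : B ≤ ι y - i
    · have ht := W_tele hμ (y := y) (i := i) (k := B - 1) (by omega)
      rw [hcast, show i + (B - 1) + 1 = i + B by omega] at ht
      have hU := U_le (y := y) hm0 hm1 (i + B)
      have habs : |((i + B : ℕ) : ℝ) - ι y| = ((ι y : ℝ) - i) - B := by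
        have : (i : ℝ) + B ≤ ι y := by exact_mod_cast (by omega : i + B ≤ ι y)
        push_cast
        rw [abs_of_nonpos (by linarith)]; ring
      have hexp : Real.exp (-((B : ℝ)⁻¹ / 2 * (((ι y : ℝ) - i) - B)))
          = Real.exp (1 / 2) * Real.exp (-((B : ℝ)⁻¹ / 2 * ((ι y : ℝ) - i))) := by
        rw [← Real.exp_add]; congr 1; linear_combination ((1 : ℝ) / 2) * hmB
      rw [habs, h4, hexp] at hU
      have key : (B : ℝ) * (U n B ((B : ℝ)⁻¹ ^ 2) y (i + 1) - U n B ((B : ℝ)⁻¹ ^ 2) y i)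
          ≤ (B : ℝ) * (4 * Real.exp (1 / 2) * Real.exp (-((B : ℝ)⁻¹ / 2 * ((ι y : ℝ) - i)))) := by
        linarith
      exact le_of_mul_le_mul_left key hB'
    · have h1 := W_mono hμ (y := y) (by omega : i ≤ ι y - 1) (by omega)
      have h2 := W_src_le_one (y := y) hμ (by omega)
      rw [Nat.sub_add_cancel (by omega : 1 ≤ ι y)] at h1
      have hdB : (ι y : ℝ) - i < B := by
        have : ι y < i + B := by omega
        have : (ι y : ℝ) < i + B := by exact_mod_cast this
        linarith
      have hd0 : (0 : ℝ) ≤ (ι y : ℝ) - i := by linarith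
      linarith [hnear _ hd0 hdB]
  · -- at the source
    subst hib
    rw [abs_sub_comm, abs_of_nonneg (D_nonneg (y := y) hμ (le_refl _)), sub_self, abs_zero, mul_zero,
      neg_zero, Real.exp_zero, mul_one]
    linarith [D_src_le_one (y := y) hμ]
  · -- right of the source
    have hD := D_nonneg hμ (y := y) (le_of_lt hib)
    have hlt : (ι y : ℝ) < i := by exact_mod_cast hib
    have habs' : |(i : ℝ) - ι y| = (i : ℝ) - ι y := abs_of_nonneg (by linarith)
    rw [abs_sub_comm, abs_of_nonneg hD, habs']
    by_cases hd : B ≤ i - ι y + 1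
    · have ht := D_tele hμ (y := y) (a₀ := i + 1 - B) (k := B - 1) (by omega)
      rw [show i + 1 - B + (B - 1) = i by omega, hcast] at ht
      have hU := U_le (y := y) hm0 hm1 (i + 1 - B)
      have habs : |((i + 1 - B : ℕ) : ℝ) - ι y| = (i : ℝ) - ι y - B + 1 := by
        have : (ι y : ℝ) + B ≤ i + 1 := by exact_mod_cast (by omega : ι y + B ≤ i + 1)
        rw [Nat.cast_sub (by omega : B ≤ i + 1)]
        push_cast
        rw [abs_of_nonneg (by linarith)]; ring
      have hexp : Real.exp (-((B : ℝ)⁻¹ / 2 * ((i : ℝ) - ι y - B + 1)))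
          ≤ Real.exp (1 / 2) * Real.exp (-((B : ℝ)⁻¹ / 2 * ((i : ℝ) - ι y))) := by
        rw [← Real.exp_add]
        apply Real.exp_le_exp.mpr
        nlinarith [hm0, hmB]
      rw [habs, h4] at hU
      have := hU.trans (mul_le_mul_of_nonneg_left hexp (by positivity))
      have key : (B : ℝ) * (U n B ((B : ℝ)⁻¹ ^ 2) y i - U n B ((B : ℝ)⁻¹ ^ 2) y (i + 1))
          ≤ (B : ℝ) * (4 * Real.exp (1 / 2) * Real.exp (-((B : ℝ)⁻¹ / 2 * ((i : ℝ) - ι y)))) := by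
        linarith
      exact le_of_mul_le_mul_left key hB'
    · have h1 := (D_anti hμ (y := y) (le_refl _) (le_of_lt hib)).trans (D_src_le_one hμ)
      have hdB : (i : ℝ) - ι y < B := by
        have : i < ι y + B := by omega
        have : (i : ℝ) < ι y + B := by exact_mod_cast this
        linarith
      linarith [hnear _ (by linarith) hdB]

/-- GRADIENT ESTIMATE (site form) at mass `1/B`:
`|(∂G′)(x, y)| ≤ 4e^{1/2}·e^{−|ι x − ι y|/(2B)}` — an `O(1)` bound, a factor `B` better than the bound
on `G′` itself. [folklore] -/
theorem DGr_entry_le (hB : 0 < B) (x y : Fin n × Fin B) :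
    |(Dfw n B * Gr n B ((B : ℝ)⁻¹ ^ 2)) x y|
      ≤ 4 * Real.exp (1 / 2) * Real.exp (-((B : ℝ)⁻¹ / 2 * |(ι x : ℝ) - ι y|)) := by
  rw [DGr_apply]; exact absW_le hB (ι x)

end Gradient

/-! ## §7 The block form of the gradient: `∂G′ ∈ 𝒟(0, 1, c)` with a `B`-free `c` -/

section GradientBlock

variable {n B : ℕ} {N : Finset (Fin n)} {hN : N.Nonempty} {δ₀ : ℝ}

/-- block row sums of the gradient of the Green's function at mass `1/B`. [folklore] -/
theorem DGr_block_rowsum (hB : 0 < B) (x : Fin n × Fin B) (J : Fin n) :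
    ∑ y ∈ univ.filter (fun y : Fin n × Fin B => y.1 = J), |(Dfw n B * Gr n B ((B : ℝ)⁻¹ ^ 2)) x y|
      ≤ 4 * Real.exp 1 * (B : ℝ) * Real.exp (-(1 / 2 * bdist n x.1 J)) := by
  have hee : Real.exp (1 / 2) * Real.exp (1 / 2) = Real.exp 1 := by rw [← Real.exp_add]; norm_num
  have hterm : ∀ y ∈ univ.filter (fun y : Fin n × Fin B => y.1 = J),
      |(Dfw n B * Gr n B ((B : ℝ)⁻¹ ^ 2)) x y| ≤ 4 * Real.exp 1 * Real.exp (-(1 / 2 * bdist n x.1 J)) := by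
    intro y hy
    rw [mem_filter] at hy
    rw [← hy.2]
    calc |(Dfw n B * Gr n B ((B : ℝ)⁻¹ ^ 2)) x y|
        ≤ 4 * Real.exp (1 / 2) * Real.exp (-((B : ℝ)⁻¹ / 2 * |(ι x : ℝ) - ι y|)) := DGr_entry_le hB x y
      _ ≤ 4 * Real.exp (1 / 2) * (Real.exp (1 / 2) * Real.exp (-(1 / 2 * bdist n x.1 y.1))) :=
          mul_le_mul_of_nonneg_left (site_factor_le hB x y) (by positivity)
      _ = 4 * Real.exp 1 * Real.exp (-(1 / 2 * bdist n x.1 y.1)) := by rw [← hee]; ring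
  have hcard := card_block_le (n := n) (B := B) J
  calc ∑ y ∈ univ.filter (fun y : Fin n × Fin B => y.1 = J), |(Dfw n B * Gr n B ((B : ℝ)⁻¹ ^ 2)) x y|
      ≤ ∑ y ∈ univ.filter (fun y : Fin n × Fin B => y.1 = J),
          4 * Real.exp 1 * Real.exp (-(1 / 2 * bdist n x.1 J)) := sum_le_sum hterm
    _ = (univ.filter (fun y : Fin n × Fin B => y.1 = J)).card
          * (4 * Real.exp 1 * Real.exp (-(1 / 2 * bdist n x.1 J))) := by rw [sum_const, nsmul_eq_mul]
    _ ≤ (B : ℝ) * (4 * Real.exp 1 * Real.exp (-(1 / 2 * bdist n x.1 J))) :=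
        mul_le_mul_of_nonneg_right (by exact_mod_cast hcard) (by positivity)
    _ = _ := by ring

/-- THE `(M)`-FIELD SHAPE OF THE GRADIENT WITH A `B`-FREE CONSTANT: at mass `1/B` the gradient
`∂G′ = ∂(∂*∂ + B⁻²)⁻¹` of the toy belongs to `𝒟(0, 1, 4e)` on the toy frame (class `k = 1`: one power
of the scale `B` less than `G′`), for any decay-rate parameter `δ₀ ≤ 1/2` of the frame. [folklore] -/
theorem DGr_opDec (hB : 0 < B) (hδ : δ₀ ≤ 1 / 2) :
    OpDec (toyFrame n B N hN δ₀) Prod.fst Prod.fst id id 0 1 (4 * Real.exp 1)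
      (Dfw n B * Gr n B ((B : ℝ)⁻¹ ^ 2)) := by
  refine ⟨fun I J => 4 * Real.exp 1 * (B : ℝ) * Real.exp (-(δ₀ * bdist n I J)), ⟨?_, ?_⟩, ?_⟩
  · intro I J; positivity
  · intro x J
    refine (DGr_block_rowsum hB x J).trans ?_
    refine mul_le_mul_of_nonneg_left (Real.exp_le_exp.mpr ?_) (by positivity)
    nlinarith [bdist_nonneg (n := n) x.1 J]
  · intro I J
    simp only [toyFrame_ρ, toyFrame_sc, Frame.rate_zero, toyFrame_δ₀, id, zpow_one]
    rw [abs_of_nonneg (by positivity)]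

end GradientBlock

end

end Literature.MathematicalPhysics.QuantumFieldTheory.Balaban1983to89.B9SectCDiffCutModelToy5
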